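import Summits.ABC.IUTFork.Cor312VolumesRealArch
import Summits.ABC.IUTFork.Thm311RealDegree
import HarnessLib

/-!
# [IUTchIII] Corollary 3.12, statement — the verbatim container of the REAL log-shells with BOTH repairs at once:
# PROBABILITY weights at the finite primes AND the honest archimedean term

Record-only file (D-0012) of the abc-iut cell (WAVE-5 prover seat abc-iut-w5-d043, gen 2; «PR-ARCH MERGE» offer of
2026-08-26T03:14Z, first refusal to abc-iut-w5-d163 g2 / abc-iut-c312-1 g5); TAKES NO SIDE on [IUTchIII]
Cor. 3.12.  Nothing of another seat's file is edited or restated: the two presentations are IMPORTED BY NAME.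

abc-iut-c312-5's verbatim container for the real Dupuy–Hilado-level log-shells `Real.logShellsDH X logv`
(`Cor312VolumesRealDH` / `…RealAssembly`) has two documented defects relative to print, each repaired tonight in
a separate file:
* at `v_ℚ = p`: the CONSTANT weight `Real.weightDH = 1/[F:ℚ]^{j+1}` multiplies abc-iut-c312-3's NORMALISED summand
  log-measure `packetLogμ`, so every packet log-volume is print's times `(#𝕍(F)_p/[F:ℚ])^{j+1}` (finding
  F-c312-1-g5-1) — REPAIRED by abc-iut-c312-1's probability weights `Pr(v⃗) = Π_a n_{v_a}/[F:ℚ]^{j+1}`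
  (`Real.padicPresentationPr`, `Thm311RealDegree`; [IUTchIII] Rmk. 3.1.1 (ii) p. 94, Dupuy–Hilado §3.6);
* at `v_ℚ = ∞`: the TRIVIAL one-point container (log-volume `0`) — REPAIRED by abc-iut-w5-d163's archimedean
  presentation `Real.archPresentationDH` (`Cor312VolumesRealArch`; the real archimedean packet
  `⊗_ℝ ⊕_{v|∞} ℂ_v` of [IUTchIV] Prop. 1.5 (iii) with its normalised radial log-volume, [IUTchIII] Prop. 3.9 (i),
  under [IUTchI] Def. 3.1 (a) "`√−1 ∈ F`").
But `Thm311RealDegree` keeps the trivial `∞` and `Cor312VolumesRealArch` keeps `weightDH` at the primes, so NO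
landed container is print-normalised at EVERY place.  THIS file is the merge:

* `Real.localPiecesPrArch` / `Real.summandPiecesPrArch` — probability-weighted `p`-adic pieces at every prime,
  honest archimedean pieces at `∞`; `Real.generatorsPreserve_summandPiecesPrArch` ((Ind1)/(Ind2) generator facts
  at every place, from `generatorsPreservePr` and `generatorsPreserveDHArch`);
* `Real.situationDHVolPrArch` — abc-iut-c312-5's `Situation.ofShells` carrying THIS container — with the A-0
  consequences transplanted verbatim: `realizes_…`, `adm_and_logvol_eq_of_mem_indGroup_PrArch` (B's
  `LogvolInvariant` shape along the whole indeterminacy subgroup), `adm_and_logvol_possibleImage_eq_PrArch`,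
  `bridgeHyps_PrArch` (abc-iut-c312-6's `BridgeHyps` with `mono`/`image_adm`/`image_fin`/`theta_nonempty`
  DISCHARGED; the same named residuals `hθ`/`hfin`/`hul_nonempty`/`ThetaFinite`);
* `Real.summandPiecesPrArch_logμ_inr` / `_w_inr` — at the primes the merged container IS c312-1's (definitional),
  so c312-1's packet-normalisation certificate `logvol_p_mul_Pr` («×p ↦ −log p») and degree computation
  `logvol_idealRegion_inr` apply to it verbatim at `v_ℚ = p`.

Deliberately NOT here: the `Cor312.Setting` over `situationDHVolPrArch` (c312-7 `Setting.ofComparison` lineage;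
abc-iut-w5-d163's staged `Cor312SettingDHVolArch` pattern applies with `summandPiecesPrArch` in place of
`summandPiecesDHArch`); the degree clause at `∞` (c312-1's `idealRegion` puts `Set.univ` at `∞`, which is NOT
admissible in the honest archimedean container — the natural replacement is the unit polydisc `B_I`, log-volume
`0`; a follow-up); any judgement. [claim: Mochizuki2012, status: disputed] for the quoted containers; classical
elsewhere. typed ≠ proved; instantiated ≠ endorsed.
-/

noncomputable section

open Set Function NumberField IsDedekindDomain
open scoped Pointwise

namespace Summit.ABC

namespace IUTFork

namespace Thm311

namespace Real

open Cor312 Cor312Vol Literature.IUT.LogThetaLattice Literature.IUT.LogVolume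

variable {F : Type} [Field F] [NumberField F] (X : PilotData F) {logv : PadicLogs F}

/-! ## 1. The merged local pieces: probability weights at `p`, honest archimedean term at `∞` -/

/-- **The local pieces of the real Dupuy–Hilado-level signature at every place, BOTH repairs applied**: at
`v_ℚ = p` abc-iut-c312-1's probability-weighted `p`-adic presentation (`Real.padicPresentationPr`), at `v_ℚ = ∞`
abc-iut-w5-d163's archimedean presentation (`Real.archPresentationDH`, under "`√−1 ∈ F`").
[claim: Mochizuki2012, status: disputed] -/
def localPiecesPrArch (hlog : LogvAnalytic logv) (hc : ∀ w : InfinitePlace F, w.IsComplex) :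
    ∀ vQ : (thetaIndex X).VQ, LocalPieces (logShellsDH X logv) vQ
  | .inl _ => (archPresentationDH X logv hc).toLocalPieces
  | .inr pp => haveI : Fact (pp : ℕ).Prime := ⟨pp.2⟩; (padicPresentationPr X pp.1 logv (hlog pp)).toLocalPieces

/-- **The verbatim container of the real log-shells, print-normalised at EVERY place** (`SummandPieces.ofLocal`
of `localPiecesPrArch`). [claim: Mochizuki2012, status: disputed] -/
def summandPiecesPrArch (hlog : LogvAnalytic logv) (hc : ∀ w : InfinitePlace F, w.IsComplex) :
    SummandPieces (logShellsDH X logv) :=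
  SummandPieces.ofLocal (localPiecesPrArch X hlog hc)

/-- At a prime the merged local pieces ARE abc-iut-c312-1's probability-weighted ones (definitional).
[folklore] -/
theorem localPiecesPrArch_inr (hlog : LogvAnalytic logv) (hc : ∀ w : InfinitePlace F, w.IsComplex)
    (pp : Nat.Primes) :
    localPiecesPrArch X hlog hc (.inr pp) = localPiecesPr X hlog (.inr pp) := rfl

/-- At `∞` the merged local pieces ARE abc-iut-w5-d163's archimedean ones (definitional). [folklore] -/
theorem localPiecesPrArch_inl (hlog : LogvAnalytic logv) (hc : ∀ w : InfinitePlace F, w.IsComplex)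
    (u : Unit) :
    localPiecesPrArch X hlog hc (.inl u) = localPiecesDHArch X hlog hc (.inl u) := rfl

/-- **The (Ind1)/(Ind2) generator hypotheses HOLD for the merged container at every place** (capsule
permutations with symmetric probability weights and Dupuy–Hilado (Ind2)-automorphisms at `p`:
`generatorsPreservePr`; the isometries `±1` of `ℂ` at `∞`: `generatorsPreserveDHArch`).
[cite: DupuyHilado2025, §4.7, §4.9] -/
theorem generatorsPreserve_summandPiecesPrArch (hlog : LogvAnalytic logv)
    (hc : ∀ w : InfinitePlace F, w.IsComplex) : (summandPiecesPrArch X hlog hc).GeneratorsPreserve :=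
  SummandPieces.generatorsPreserve_ofLocal _ fun vQ =>
    match vQ with
    | .inl _ => generatorsPreserveDHArch X logv hc
    | .inr pp => by haveI : Fact (pp : ℕ).Prime := ⟨pp.2⟩; exact generatorsPreservePr X pp.1 logv (hlog pp)

/-- The merged container for the ANALYTIC logarithm family under "`√−1 ∈ F`". [claim: Mochizuki2012, status: disputed] -/
def summandPiecesPrArchAnalytic (hc : ∀ w : InfinitePlace F, w.IsComplex) :
    SummandPieces (logShellsDH X (analyticLogv F)) :=
  summandPiecesPrArch X (logvAnalytic_analyticLogv (F := F)) hc

/-- … and its generator facts. [claim: Mochizuki2012, status: disputed] -/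
theorem generatorsPreserve_summandPiecesPrArchAnalytic (hc : ∀ w : InfinitePlace F, w.IsComplex) :
    (summandPiecesPrArchAnalytic X hc).GeneratorsPreserve :=
  generatorsPreserve_summandPiecesPrArch X _ hc

/-! ## 2. The situation of Theorem 3.11 over the real log-shells carrying the merged container -/

section Consequences

variable (hlog : LogvAnalytic logv) (hc : ∀ w : InfinitePlace F, w.IsComplex) (M : Type) [Field M] [NumberField M]
  (archPk : ∀ (j : (thetaIndex X).Label) (vQ : (thetaIndex X).VQ), Set ((logShellsDH X logv).Packet j vQ))
  (archSub : ∀ (j : (thetaIndex X).Label) (v : (thetaIndex X).V),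
    Set ((logShellsDH X logv).Packet j ((thetaIndex X).over v)))
  (Ψ : ℤ → ∀ v : (thetaIndex X).V, v ∈ (thetaIndex X).Vbad → Set ((logShellsDH X logv).StarPacket v))
  (act : ℤ → ∀ v : (thetaIndex X).V, v ∈ (thetaIndex X).Vbad →
    (logShellsDH X logv).StarPacket v → Module.End ℚ ((logShellsDH X logv).StarPacket v))
  (Mmod : ℤ → ∀ j : (thetaIndex X).LabelStar, Set ((logShellsDH X logv).GlobalPacket j.1))
  (region : ℤ → ∀ j : (thetaIndex X).LabelStar, FinDivisor M → ∀ vQ : (thetaIndex X).VQ,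
    Set ((logShellsDH X logv).Packet j.1 vQ))

/-- **The situation of Thm. 3.11 over the real Dupuy–Hilado-level log-shells with the container print-normalised
at every place** (abc-iut-c312-5's `Situation.ofShells` with `Adm`/`logvol` := the merged container).
[claim: Mochizuki2012, status: disputed] -/
abbrev situationDHVolPrArch : Situation (thetaIndex X) :=
  Situation.ofShells (logShellsDH X logv) M archPk archSub (summandPiecesPrArch X hlog hc).Adm
    (summandPiecesPrArch X hlog hc).logvol Ψ act Mmod region

/-- Every line of `situationDHVolPrArch` carries the merged container. [folklore] -/
theorem realizes_situationDHVolPrArch (n : ℤ) :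
    (summandPiecesPrArch X hlog hc).Realizes
      ((situationDHVolPrArch X hlog hc M archPk archSub Ψ act Mmod region).D n) :=
  ⟨fun _ _ _ => Iff.rfl, fun _ _ _ => rfl⟩

/-- **(Ind1)/(Ind2) INVARIANCE ALONG THE WHOLE INDETERMINACY SUBGROUP for the merged container** ([IUTchIII]
proof of Cor. 3.12, Step (x), p. 181: "invariant with respect to the indeterminacies (Ind1), (Ind2)"): every
`Φ ∈ ⟨Ind1Family ∪ Ind2Family⟩` carries admissible regions to admissible regions of the same log-volume — B's
`MRData.LogvolInvariant` shape, now with BOTH the finite primes and `∞` print-normalised.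
[claim: Mochizuki2012, status: disputed] -/
theorem adm_and_logvol_eq_of_mem_indGroup_PrArch (n : ℤ) {Φ : (logShellsDH X logv).PacketAut}
    (hΦ : Φ ∈ Subgroup.closure ((logShellsDH X logv).Ind1Family ∪ (logShellsDH X logv).Ind2Family))
    (j : (thetaIndex X).Label) (vQ : (thetaIndex X).VQ) (A : Set ((logShellsDH X logv).Packet j vQ))
    (hA : ((situationDHVolPrArch X hlog hc M archPk archSub Ψ act Mmod region).D n).Adm j vQ A) :
    ((situationDHVolPrArch X hlog hc M archPk archSub Ψ act Mmod region).D n).Adm j vQ (Φ j vQ '' A) ∧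
      ((situationDHVolPrArch X hlog hc M archPk archSub Ψ act Mmod region).D n).logvol j vQ (Φ j vQ '' A) =
        ((situationDHVolPrArch X hlog hc M archPk archSub Ψ act Mmod region).D n).logvol j vQ A :=
  SummandPieces.adm_and_logvol_eq_of_mem_indGroup
    (realizes_situationDHVolPrArch X hlog hc M archPk archSub Ψ act Mmod region n)
    (generatorsPreserve_summandPiecesPrArch X hlog hc) hΦ j vQ A hA

variable (P : Cor312.Setting (situationDHVolPrArch X hlog hc M archPk archSub Ψ act Mmod region))

/-- **Every possible image of the Θ-pilot object is admissible with the Θ-region's log-volume**, for the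
merged container, as soon as the (Ind3)-enlarged Θ-region is admissible. [claim: Mochizuki2012, status: disputed] -/
theorem adm_and_logvol_possibleImage_eq_PrArch {j : (thetaIndex X).Label} {vQ : (thetaIndex X).VQ}
    (hθ : ((situationDHVolPrArch X hlog hc M archPk archSub Ψ act Mmod region).D P.n).Adm j vQ
      (P.thetaRegion3 j vQ))
    {U : Set ((logShellsDH X logv).Packet j vQ)} (hU : U ∈ P.possibleImages j vQ) :
    ((situationDHVolPrArch X hlog hc M archPk archSub Ψ act Mmod region).D P.n).Adm j vQ U ∧
      ((situationDHVolPrArch X hlog hc M archPk archSub Ψ act Mmod region).D P.n).logvol j vQ U =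
        ((situationDHVolPrArch X hlog hc M archPk archSub Ψ act Mmod region).D P.n).logvol j vQ
          (P.thetaRegion3 j vQ) :=
  SummandPieces.adm_and_logvol_possibleImage_eq
    (realizes_situationDHVolPrArch X hlog hc M archPk archSub Ψ act Mmod region P.n)
    (generatorsPreserve_summandPiecesPrArch X hlog hc) hθ hU

/-- **abc-iut-c312-6's `BridgeHyps` with `mono`, `image_adm`, `image_fin`, `theta_nonempty` DISCHARGED for the
merged container** — remaining named inputs exactly as in c312-5's `bridgeHyps_DH` / w5-d163's `bridgeHyps_DHArch`.
[claim: Mochizuki2012, status: disputed] -/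
theorem bridgeHyps_PrArch
    (hθ : ∀ (i : Fin (thetaIndex X).lstar) (vQ : (thetaIndex X).VQ),
      ((situationDHVolPrArch X hlog hc M archPk archSub Ψ act Mmod region).D P.n).Adm _ vQ
        (P.thetaRegion3 (Setting.labelSucc i) vQ))
    (hfin : ∀ i : Fin (thetaIndex X).lstar, (Function.support fun vQ : (thetaIndex X).VQ =>
      ((situationDHVolPrArch X hlog hc M archPk archSub Ψ act Mmod region).D P.n).logvol _ vQ
        (P.thetaRegion3 (Setting.labelSucc i) vQ)).Finite)
    (hul_nonempty : ∀ (j : (thetaIndex X).Label) (vQ : (thetaIndex X).VQ), ∀ H ∈ (P.frame j vQ).Hul, H.Nonempty)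
    (finite : P.ThetaFinite) : BridgeHyps P :=
  SummandPieces.bridgeHyps_of_summands
    (realizes_situationDHVolPrArch X hlog hc M archPk archSub Ψ act Mmod region P.n)
    (generatorsPreserve_summandPiecesPrArch X hlog hc) hθ hfin hul_nonempty finite

end Consequences

/-! ## 3. At the primes the merged container is c312-1's: the packet-normalisation and the degree computation
transfer verbatim -/

/-- The admissibility predicate of the merged container at a prime is c312-1's (definitional). [folklore] -/
theorem summandPiecesPrArch_adm_inr (hlog : LogvAnalytic logv) (hc : ∀ w : InfinitePlace F, w.IsComplex)
    (j : (thetaIndex X).Label) (pp : Nat.Primes) (A : Set ((logShellsDH X logv).Packet j (.inr pp))) :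
    (summandPiecesPrArch X hlog hc).Adm j (.inr pp) A ↔ (summandPiecesPr X hlog).Adm j (.inr pp) A := Iff.rfl

/-- The log-volume of the merged container at a prime is c312-1's (definitional) — so `logvol_p_mul_Pr`
(«×p ↦ −log p», `Thm311RealDegreeFull`) and `logvol_idealRegion_inr` (`Thm311RealDegree`) hold for it at every
`v_ℚ = p` by rewriting along this equation. [folklore] -/
theorem summandPiecesPrArch_logvol_inr (hlog : LogvAnalytic logv) (hc : ∀ w : InfinitePlace F, w.IsComplex)
    (j : (thetaIndex X).Label) (pp : Nat.Primes) (A : Set ((logShellsDH X logv).Packet j (.inr pp))) :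
    (summandPiecesPrArch X hlog hc).logvol j (.inr pp) A = (summandPiecesPr X hlog).logvol j (.inr pp) A := rfl

/-- The log-volume of the merged container at `∞` is w5-d163's honest archimedean one (definitional) — so the
Step (vii) container `π^{j+1}·B_I` has log-volume `(j+1)·log π` there (`logvol_thetaContainer_arch`).
[folklore] -/
theorem summandPiecesPrArch_logvol_inl (hlog : LogvAnalytic logv) (hc : ∀ w : InfinitePlace F, w.IsComplex)
    (j : (thetaIndex X).Label) (u : Unit) (A : Set ((logShellsDH X logv).Packet j (.inl u))) :
    (summandPiecesPrArch X hlog hc).logvol j (.inl u) A = (summandPiecesDHArch X hlog hc).logvol j (.inl u) A :=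
  rfl

/-! ## 4. The archimedean UNIT STRUCTURE `B_I` of the merged container: admissible, log-volume `0`
(the region at `∞` that abc-iut-c312-1's `idealRegion` should carry instead of `Set.univ`) -/

section ArchUnit

open Literature.IUT.LogVolume.Prop15iii Literature.IUT.LogVolume.ArchPacket

attribute [local instance] Cor312Vol.ArchPresentation.fibreFintype

variable (hlog : LogvAnalytic logv) (hc : ∀ w : InfinitePlace F, w.IsComplex)

/-- The unit structure `B_I = Φ₀⁻¹(unit polydisc)` of the real archimedean packet `M_I` is admissible downstairs
(`r·B_I` with `r = 1`; abc-iut-w5-d163's `ArchPresentation.adm_smul_ball`). [folklore] -/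
theorem archUnit_adm (j : (thetaIndex X).Label) :
    ArchPresentation.adm (T := thetaIndex X) (Sum.inl ()) j
      (ball (ArchPresentation.Φ₀ (T := thetaIndex X) (Sum.inl ()) j)) := by
  have h := ArchPresentation.adm_smul_ball (T := thetaIndex X) (vQ := Sum.inl ()) j one_pos
  rwa [one_smul] at h

/-- **The archimedean unit structure `B_I`, pulled back to the `ℚ`-packet of the real log-shells, is ADMISSIBLE in
the merged container** — whereas the whole packet `Set.univ` (the region abc-iut-c312-1's `idealRegion` puts at
`∞` under the trivial container) has infinite volume downstairs and is not admissible here.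
[claim: Mochizuki2012, status: disputed] -/
theorem adm_unitStructure_arch (j : (thetaIndex X).Label) :
    (summandPiecesPrArch X hlog hc).Adm j (.inl ())
      ((archPresentationDH X logv hc).comparison j ⁻¹'
        ball (ArchPresentation.Φ₀ (T := thetaIndex X) (Sum.inl ()) j)) :=
  (archPresentationDH X logv hc).adm_preimage_of_adm j (archUnit_adm X j)

/-- **… and its log-volume is `0`** (L5-t7 `packetLogVol_ball`: the normalised packet log-volume is normalised by
`B_I ↦ 0`; [IUTchIII] Prop. 3.9 (i) "the log-volume of each of the local holomorphic integral structures … is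
equal to zero") — so with integer-divisor objects (no archimedean component) the degree clause's archimedean
term vanishes for THIS region exactly as it did (for `Set.univ`) under the trivial container.
[claim: Mochizuki2012, status: disputed] -/
theorem logvol_unitStructure_arch (j : (thetaIndex X).Label) :
    (summandPiecesPrArch X hlog hc).logvol j (.inl ())
      ((archPresentationDH X logv hc).comparison j ⁻¹'
        ball (ArchPresentation.Φ₀ (T := thetaIndex X) (Sum.inl ()) j)) = 0 := by
  rw [SummandPieces.logvol_eq_of_pi (R := fun _ : Unit => _)
    ((archPresentationDH X logv hc).e_image_preimage j _) (fun _ => archUnit_adm X j)]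
  show ∑ _u : Unit, (1 : ℝ) * ArchPresentation.logμ (T := thetaIndex X) (Sum.inl ()) j _ = _
  rw [Fintype.sum_unique, one_mul]
  exact packetLogVol_ball _

/-- For comparison: the Step (vii) Θ-container `π^{j+1}·B_I` keeps its log-volume `(j+1)·log π` in the merged
container (abc-iut-w5-d163's `logvol_thetaContainer_arch`, definitionally the same archimedean pieces).
[claim: Mochizuki2012, status: disputed] -/
theorem logvol_thetaContainer_prArch (j : (thetaIndex X).Label) :
    (summandPiecesPrArch X hlog hc).logvol j (.inl ())
      ((archPresentationDH X logv hc).comparison j ⁻¹'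
        (Real.pi ^ Fintype.card ((thetaIndex X).Caps j) •
          ball (ArchPresentation.Φ₀ (T := thetaIndex X) (Sum.inl ()) j))) =
      Fintype.card ((thetaIndex X).Caps j) * Real.log Real.pi :=
  logvol_thetaContainer_arch X hlog hc j

end ArchUnit

end Real

end Thm311

end IUTFork

end Summit.ABC

end
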